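import Summits.ABC.IUTFork.Cor312TeamAGapWitnessB
import Summits.ABC.IUTFork.Cor312ProvenanceReal
import HarnessLib

/-!
# TEAM A gap witness, part C: EVERY index skeleton, prescribed `−|log(q)|`, and the PROVENANCE-LEVEL isolation

Record-only file (D-0012) of the abc-iut cell (Cor. 3.12 cone, D-0067; support piece A-4′ for TEAM A row A-4,
wave-4 seat abc-iut-w4-d026; ADJUDICATION-SPEC §1 last bullet / §2 (G3)); TAKES NO SIDE; companion of A1's
`Cor312TeamAGapWitness(B)` (p411327/p411346) and abc-iut-c312-8's `Cor312Provenance(Real)`.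
A1 proved (`GapWitness.thm311_bridgeHyps_not_imp_statement`, over `toyIndex`): typed Thm. 3.11 + `BridgeHyps` +
`|log(q)| > 0` do NOT entail typed Cor. 3.12; the spec then lists "provenance `IsSettingOf`, the real containers,
the link data" as what a (P)-theorem must consume. THIS FILE asks: **does provenance help?** It transplants A1's
two-valued log-volume to an ARBITRARY `T : Thm311.ThetaIndex` (log-shells `ℚ`, NONTRIVIAL tensor packets —
`packet_nontrivial`), supported at ONE place `v_ℚ⁰`, scaled by any `c > 0` (Θ-image `{0}` ↦ `−2c`, q-image = packet
↦ `−c`): `exists_gapWitness` gives typed Thm. 3.11 (i)∧(ii)∧(iii), all bridge hypotheses, `|log(q)| > 0`,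
`−|log(q)| = −c` EXACTLY, `¬ Statement`. With `T := Thm311.Real.thetaIndexOfInitial D` (c312-5) and `c := absLogq D`
([IUTchIV] p. 23), c312-8's `isSettingOf_ofInitial` yields **`thm311_bridgeHyps_isSettingOf_not_imp_statement`**:
for EVERY initial Θ-datum `D` with `log(q) > 0` there is a setting that IS "the situation of `D`"
(`Cor312Prov.IsSettingOf D P`), satisfies typed Thm. 3.11 in full + every bridge hypothesis + `|log(q)| > 0`, and
VIOLATES typed Cor. 3.12 — so «provenance» can be struck from the (P)-inputs list: the non-following inference
sits in the glue fields `Cor312.Setting.thetaRegionOf`/`qRegionOf` (RESIDUALS R1/R2, the REAL Kummer-image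
containers), at Step (xi) strength. HONEST SCOPE as A1's: interface/provenance level only (typed Thm. 3.11 holds
on degenerate data: `Ψ = ∅`, `M_mod = ∅`, unit images = packet = integral structure, one-object link data;
`IsSettingOf` pins the index and the NUMBER `−|log(q)|`, not the regions); no judgement on print; no `Prop` fact;
axioms standard. [claim: Mochizuki2012, status: disputed] [cite: ScholzeStix2018, §2.2 pp. 9–10]
-/

noncomputable section
noncomputable section

namespace Summit.ABC

namespace IUTFork

namespace Cor312Vol

namespace GapWitnessProv

open Thm311 Cor312 Cor312.Checks Cor312Vol.GapWitness Literature.IUT.LogThetaLattice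

variable (T : ThetaIndex)

/-- `log(D⊢_v) := ℚ` at EVERY `v ∈ V` of an arbitrary index skeleton `T`, the log-shell all of it, only the
identity acting (the index-generic form of `Thm311.Checks.toyShells`). [folklore] -/
def lineShells : LogShells T where
  carrier := fun _ => ℚ
  shell := fun _ => Set.univ
  stripAut := fun _ => {LinearEquiv.refl ℚ ℚ}
  ism := fun _ => {LinearEquiv.refl ℚ ℚ}
  one_mem_stripAut := fun _ => rfl
  one_mem_ism := fun _ => rfl

variable {T}

/-- Coordinate functional of the `(j+1)`-tensor packet at `v₀ | v_ℚ`: project each factor to `v₀`, multiply. [folklore] -/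
def packetCoord (j : T.Label) (vQ : T.VQ) (v₀ : T.Fibre vQ) : (lineShells T).Packet j vQ →ₗ[ℚ] ℚ :=
  (PiTensorProduct.constantBaseRingEquiv (T.Caps j) ℚ).toLinearEquiv.toLinearMap ∘ₗ
    PiTensorProduct.map fun _ : T.Caps j => (LinearMap.proj v₀ : (lineShells T).Packet1 vQ →ₗ[ℚ] ℚ)

/-- The coordinate functional takes the value `1` on the pure tensor of all-ones vectors. [folklore] -/
theorem packetCoord_tprod_one (j : T.Label) (vQ : T.VQ) (v₀ : T.Fibre vQ) :
    packetCoord j vQ v₀ ((lineShells T).tprod j vQ fun _ _ => (1 : ℚ)) = 1 := by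
  unfold packetCoord LogShells.tprod
  rw [LinearMap.comp_apply]
  erw [PiTensorProduct.map_tprod]
  change (PiTensorProduct.constantBaseRingEquiv (T.Caps j) ℚ)
      (PiTensorProduct.tprod ℚ fun _ : T.Caps j => (1 : ℚ)) = 1
  rw [PiTensorProduct.constantBaseRingEquiv_tprod]
  exact Finset.prod_const_one

/-- **The tensor packets of `lineShells T` are NONTRIVIAL** (fibres are nonempty). [folklore] -/
theorem packet_nontrivial (j : T.Label) (vQ : T.VQ) : Nontrivial ((lineShells T).Packet j vQ) := by
  obtain ⟨v₀⟩ := (inferInstance : Nonempty (T.Fibre vQ))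
  refine nontrivial_of_ne ((lineShells T).tprod j vQ fun _ _ => (1 : ℚ)) 0 fun h => ?_
  have h1 := packetCoord_tprod_one j vQ v₀
  exact zero_ne_one (by rwa [h, map_zero] at h1)

/-- The whole packet is NOT contained in `{0}`. [folklore] -/
theorem univ_not_subset_zero (j : T.Label) (vQ : T.VQ) :
    ¬ (Set.univ : Set ((lineShells T).Packet j vQ)) ⊆ {0} := fun h => by
  haveI := packet_nontrivial j vQ
  obtain ⟨x, hx⟩ := exists_ne (0 : (lineShells T).Packet j vQ); exact hx (h (Set.mem_univ x))

variable (vQ₀ : T.VQ) (c : ℝ)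

open scoped Classical in
/-- The ONE log-volume of the witness: at `v_ℚ⁰`, `−2c` on subsets of `{0}`, `−c` otherwise; `0` elsewhere. [folklore] -/
def vol (j : T.Label) (vQ : T.VQ) (A : Set ((lineShells T).Packet j vQ)) : ℝ :=
  if vQ = vQ₀ then (if A ⊆ {0} then -(2 * c) else -c) else 0

/-- At `v_ℚ⁰`, a subset of `{0}` has log-volume `−2c`. [folklore] -/
theorem vol_self_of_subset {j : T.Label} {A : Set ((lineShells T).Packet j vQ₀)} (h : A ⊆ {0}) :
    vol vQ₀ c j vQ₀ A = -(2 * c) := by simp [vol, h]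

/-- At `v_ℚ⁰`, a region not inside `{0}` has log-volume `−c`. [folklore] -/
theorem vol_self_of_not_subset {j : T.Label} {A : Set ((lineShells T).Packet j vQ₀)} (h : ¬ A ⊆ {0}) :
    vol vQ₀ c j vQ₀ A = -c := by simp [vol, h]

/-- Away from `v_ℚ⁰` every region has log-volume `0`. [folklore] -/
theorem vol_of_ne {j : T.Label} {vQ : T.VQ} (h : vQ ≠ vQ₀) (A : Set ((lineShells T).Packet j vQ)) :
    vol vQ₀ c j vQ A = 0 := by simp [vol, h]

/-- The log-volume is monotone on ALL regions when `0 ≤ c`. [folklore] -/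
theorem vol_mono (hc : 0 ≤ c) {j : T.Label} {vQ : T.VQ} {A B : Set ((lineShells T).Packet j vQ)}
    (hAB : A ⊆ B) : vol vQ₀ c j vQ A ≤ vol vQ₀ c j vQ B := by
  by_cases hv : vQ = vQ₀
  · subst hv
    by_cases hB : B ⊆ {0}
    · rw [vol_self_of_subset vQ c (hAB.trans hB), vol_self_of_subset vQ c hB]
    · rw [vol_self_of_not_subset vQ c hB]
      by_cases hA : A ⊆ {0}
      · rw [vol_self_of_subset vQ c hA]; linarith
      · rw [vol_self_of_not_subset vQ c hA]
  · rw [vol_of_ne vQ₀ c hv, vol_of_ne vQ₀ c hv]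

/-- A function of the place vanishing away from `v_ℚ⁰` has finite support (`⊆ {v_ℚ⁰}`). [folklore] -/
theorem support_finite_of_ne {β : Type} [Zero β] {f : T.VQ → β} (h : ∀ vQ, vQ ≠ vQ₀ → f vQ = 0) :
    (Function.support f).Finite :=
  (Set.finite_singleton vQ₀).subset fun vQ hvQ => by
    by_contra hne
    exact hvQ (h vQ hne)

/-- Data (a)(b)(c): everything admissible, integral structures = packet, `Ψ = ∅`, `M_mod = ∅`, log-volume `vol`. [folklore] -/
def data : MRData (lineShells T) where
  shellPk := fun _ _ => Set.univ
  shellSub := fun _ _ => Set.univ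
  Adm := fun _ _ _ => True
  logvol := fun j vQ A => vol vQ₀ c j vQ A
  Ψ := fun _ _ => ∅
  act := fun _ _ _ => 0
  Mmod := fun _ => ∅

/-- Global degrees of (c): one object per label, degree `−c`, region everything (= sum of local volumes). [folklore] -/
def degrees (j : T.LabelStar) : GlobalDegrees (lineShells T) j where
  ObjMOD := Unit
  Objmod := Unit
  natIso := Equiv.refl Unit
  deg := fun _ => -c
  region := fun _ _ => Set.univ

/-- The situation: the same data on every vertical line. [folklore] -/
def situation : Situation T where
  L := lineShells T
  D := fun _ => data vQ₀ c
  G := fun _ j => degrees c j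

/-- A column whose transported data coincide with `data` and whose unit/ball images are everything. [folklore] -/
def column : Column (lineShells T) where
  frobAdm := fun _ _ _ _ => True
  frobLogvol := fun _ j vQ A => vol vQ₀ c j vQ A
  frobΨ := fun _ _ _ => ∅
  frobMmod := fun _ _ => ∅
  unitImage := fun _ _ _ _ => Set.univ
  ballImage := fun _ _ _ => Set.univ
  ObjLGP := Unit
  frobObjLGP := fun _ => Unit
  kumLGP := fun _ => Equiv.refl Unit
  ObjLgp := Unit
  frobObjLgp := fun _ => Unit
  kumLgp := fun _ => Equiv.refl Unit
  thetaPilot := fun _ => ()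

/-- The full situation: the same column everywhere and A1's one-object link data `GapWitness.gapLink`. [folklore] -/
def full : FullSituation T where
  toSituation := situation vQ₀ c
  col := fun _ => column vQ₀ c
  link := gapLink

/-- The `finsum` over the places of the log-volume of the whole packet is `−c` (one term, at `v_ℚ⁰`). [folklore] -/
theorem finsum_vol_univ (j : T.Label) : (∑ᶠ vQ : T.VQ, vol vQ₀ c j vQ Set.univ) = -c := by
  rw [finsum_eq_single _ vQ₀ fun vQ hvQ => vol_of_ne vQ₀ c hvQ _]
  exact vol_self_of_not_subset vQ₀ c (univ_not_subset_zero j vQ₀)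

/-- (i) holds: no splitting monoid, degree clause `−c = −c` (one-place support), all lines' classes coincide. [folklore] -/
theorem partI : (full vQ₀ c).PartI := by
  refine ⟨fun n v hv x hx => absurd hx (Set.notMem_empty x), fun n j J => ⟨fun _ => trivial,
    support_finite_of_ne vQ₀ fun vQ hvQ => vol_of_ne vQ₀ c hvQ _, (finsum_vol_univ vQ₀ c j.1).symm⟩,
    fun n n' => rfl⟩

/-- (ii) holds: transported data = coric data; unit/ball images sit in the (total) integral structures. [folklore] -/
theorem partII : (full vQ₀ c).toLatticeSituation.PartII := by
  intro n
  refine (Column.partII_iff _ _).2 ⟨?_, fun _ _ _ => rfl, fun _ _ => rfl, ?_⟩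
  · exact fun m j vQ A _ => ⟨trivial, rfl⟩
  · exact ⟨fun m m' j vQ _ => Set.subset_univ _,
      fun m j vQ _ => ⟨Set.subset_univ _, Set.subset_univ _, fun _ _ => Set.subset_univ _⟩⟩

/-- (iii) holds: squares of full poly-isomorphisms commute, stabilizations are free (A1's `gapLink`). [folklore] -/
theorem partIII : (full vQ₀ c).PartIII := by
  refine ⟨gapLink.partIIIa_holds, gapLink.partIIIb_holds, ?_, ?_,
    (full vQ₀ c).evalCompatUpToInd_of_multiradialCompat (partI vQ₀ c).2.2⟩
  · exact gapLink.partIIIc_of_full (fun _ => rfl) fun n m => by rintro p ⟨a, rfl⟩; rfl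
  · intro n m; exact Thm311.PolyIsoCalc.stabilized_full _ _

/-- **The typed Theorem 3.11 (i) ∧ (ii) ∧ (iii) HOLDS in the witness**, over every index skeleton. [folklore] -/
theorem full_statement : (full vQ₀ c).Statement := ⟨partI vQ₀ c, partII vQ₀ c, partIII vQ₀ c⟩

/-- One-point output of [IUTchIII] Prop. 3.7 over ANY index skeleton (index-generic `Cor312.Checks.toySig`). [folklore] -/
def pointSig : GlobalLGPFrobenioidSignature T.lstar T.V (· ∈ T.Vbad) Unit (fun _ _ => Unit)
    (fun _ => Unit) id Unit (fun _ _ => Unit) (fun _ _ => Unit) where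
  FMOD := fun _ => ()
  Fmod := fun _ => ()
  Ffrak := fun _ => ()
  isoModMOD := fun _ => ()
  isoModFrak := fun _ => ()
  isoFrakMOD := fun _ => ()
  CLGP := ()
  Clgp := ()
  FLGP := ()
  Flgp := ()
  Fgau := ()
  isoGauLGP := ()
  isoLGPlgp := ()
  isoCLGPlgp := ()
  embLGP := fun _ _ => ()
  embLgp := fun _ _ => ()
  embLGP_injective := fun a b _ => Subsingleton.elim a b
  embLgp_injective := fun a b _ => Subsingleton.elim a b
  objOfLgp := fun _ => ()
  objOfLGP := fun _ => ()
  objOfFrak := fun _ _ => ()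
  objOfMOD := fun _ _ => ()

/-- The SETTING of the witness: lattice `(n, m)`, one-point pilots, A1's hull frame `{{0}, univ}`, Θ-image `{0}` at
every `m`, q-image everything — the glue fields neither typed Thm. 3.11 nor `IsSettingOf` constrains. [folklore] -/
def setting : Setting (situation vQ₀ c) where
  n := 0
  HT := ℤ × ℤ
  LogLink := fun _ _ => Unit
  IsFull := fun _ => True
  lattice :=
    { theater := fun n m => (n, m)
      distinct := fun p q h => by simpa using h
      logLink := fun _ _ => ()
      logLink_full := fun _ _ => trivial }
  Frd := Unit
  IsoF := fun _ _ => Unit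
  Ob := fun _ => Unit
  realify := id
  Strip := Unit
  IsoS := fun _ _ => Unit
  M := fun _ _ => Unit
  sig := pointSig
  split := { Msplit := fun _ _ => ⊤, exists_gen := fun _ _ => ⟨⟨(), trivial⟩, top_unit_isGenerator _⟩ }
  ObΔ := Unit
  N := fun _ _ => Unit
  qData := { q := fun _ _ => (), q_gen := fun _ _ => unit_isGenerator _, objOf := fun _ => () }
  frame := fun j vQ => gapFrame _
  hul_adm := fun _ _ _ _ => trivial
  thetaRegionOf := fun _ _ _ _ => {0}
  qRegionOf := fun _ _ _ => Set.univ
  qRegion_mem := fun _ _ => Set.mem_insert_of_mem _ rfl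
  qSupport_finite := fun _ => support_finite_of_ne vQ₀ fun vQ hvQ => vol_of_ne vQ₀ c hvQ _

/-- The (Ind3)-enlarged Θ-region is `{0}`. [folklore] -/
theorem thetaRegion3_eq (j : T.Label) (vQ : T.VQ) : (setting vQ₀ c).thetaRegion3 j vQ = {0} :=
  show (⋃ _ : ℤ, ({0} : Set ((lineShells T).Packet j vQ))) = {0} from Set.iUnion_const _

/-- The possible images are exactly `{0}` (indeterminacies are `ℚ`-linear). [folklore] -/
theorem mem_possibleImages_iff (j : T.Label) (vQ : T.VQ) (U : Set ((lineShells T).Packet j vQ)) :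
    U ∈ (setting vQ₀ c).possibleImages j vQ ↔ U = {0} := by
  constructor
  · rintro ⟨Φ, -, rfl⟩
    rw [thetaRegion3_eq, Set.image_singleton, map_zero]
    rfl
  · rintro rfl
    exact thetaRegion3_eq vQ₀ c j vQ ▸ (setting vQ₀ c).thetaRegion3_mem_possibleImages j vQ

/-- The union of the possible images is `{0}`. [folklore] -/
theorem sUnion_possibleImages (j : T.Label) (vQ : T.VQ) :
    ⋃₀ (setting vQ₀ c).possibleImages j vQ = ({0} : Set ((lineShells T).Packet j vQ)) := by
  ext x
  simp only [Set.mem_sUnion]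
  refine ⟨?_, fun hx => ⟨{0}, (mem_possibleImages_iff vQ₀ c j vQ _).2 rfl, hx⟩⟩
  rintro ⟨U, hU, hx⟩
  rwa [(mem_possibleImages_iff vQ₀ c j vQ U).1 hU] at hx

/-- The packet hull `^{n,∘}𝒰_{j,v_ℚ}` of the witness is `{0}`. [folklore] -/
theorem thetaHull_eq (j : T.Label) (vQ : T.VQ) :
    (setting vQ₀ c).thetaHull j vQ = ({0} : Set ((lineShells T).Packet j vQ)) := by
  refine Set.Subset.antisymm ?_ ?_
  · show (gapFrame _).hull (⋃₀ (setting vQ₀ c).possibleImages j vQ) ⊆ {0}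
    exact gapFrame_hull_of_subset (sUnion_possibleImages vQ₀ c j vQ).le
  · exact ((sUnion_possibleImages vQ₀ c j vQ).symm.le).trans
      ((gapFrame ((lineShells T).Packet j vQ)).subset_hull (⋃₀ (setting vQ₀ c).possibleImages j vQ))

/-- Hulls are always defined here. [folklore] -/
theorem hullDefined (j : T.Label) (vQ : T.VQ) : (setting vQ₀ c).HullDefined j vQ := ⟨trivial, trivial⟩

/-- The local Θ-volume is `vol (…) {0}`: `−2c` at `v_ℚ⁰`, `0` elsewhere. [folklore] -/
theorem thetaLocal_eq (j : T.Label) (vQ : T.VQ) :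
    (setting vQ₀ c).thetaLocal j vQ = ((vol vQ₀ c j vQ {0} : ℝ) : WithTop ℝ) := by
  unfold Setting.thetaLocal
  rw [if_pos (hullDefined vQ₀ c j vQ)]
  show (((data vQ₀ c).logvol j vQ ((setting vQ₀ c).thetaHull j vQ) : ℝ) : WithTop ℝ) = _
  rw [thetaHull_eq]
  rfl

/-- The witness is `ThetaFinite` (every local Θ-volume is a real number, nonzero only at `v_ℚ⁰`). [folklore] -/
theorem thetaFinite : (setting vQ₀ c).ThetaFinite :=
  ⟨fun i vQ => by rw [thetaLocal_eq]; exact WithTop.coe_ne_top, fun i =>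
    support_finite_of_ne vQ₀ fun vQ hvQ => by rw [thetaLocal_eq, WithTop.untopD_coe, vol_of_ne vQ₀ c hvQ]⟩

/-- `−|log(Θ)| = −2c` in the witness. [folklore] -/
theorem negLogTheta_eq : (setting vQ₀ c).negLogTheta = ((-(2 * c) : ℝ) : WithTop ℝ) := by
  unfold Setting.negLogTheta
  rw [if_pos (thetaFinite vQ₀ c)]
  have h : ∀ i : Fin T.lstar,
      (∑ᶠ vQ : T.VQ, ((setting vQ₀ c).thetaLocal (Setting.labelSucc i) vQ).untopD 0) = -(2 * c) := by
    intro i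
    have h1 : (fun vQ : T.VQ => ((setting vQ₀ c).thetaLocal (Setting.labelSucc i) vQ).untopD 0) =
        fun vQ => vol vQ₀ c (Setting.labelSucc i) vQ {0} := by
      funext vQ
      rw [thetaLocal_eq, WithTop.untopD_coe]
    rw [h1, finsum_eq_single _ vQ₀ fun vQ hvQ => vol_of_ne vQ₀ c hvQ _]
    exact vol_self_of_subset vQ₀ c subset_rfl
  simp only [h]
  exact congrArg _ (processionNormalized_const (lt_of_lt_of_le two_pos T.two_le_lstar) _)

/-- `−|log(q)| = −c` in the witness — EXACTLY the prescribed value. [folklore] -/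
theorem negLogQ_eq : (setting vQ₀ c).negLogQ = -c := by
  unfold Setting.negLogQ
  have h : ∀ i : Fin T.lstar,
      (∑ᶠ vQ : T.VQ, (setting vQ₀ c).qLocal (Setting.labelSucc i) vQ) = -c := fun i =>
    finsum_vol_univ vQ₀ c _
  simp only [h]
  exact processionNormalized_const (lt_of_lt_of_le two_pos T.two_le_lstar) _

/-- **All bridge hypotheses of `Cor312StatementBridge` hold in the witness** (`0 ≤ c`). [folklore] -/
theorem bridgeHyps (hc : 0 ≤ c) : BridgeHyps (setting vQ₀ c) where
  mono := fun i vQ A B _ _ hAB => vol_mono vQ₀ c hc hAB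
  image_adm := fun _ _ _ _ => trivial
  image_fin := fun U => by
    refine ((Set.finite_univ : (Set.univ : Set (Fin T.lstar)).Finite).prod
      (Set.finite_singleton vQ₀)).subset fun t ht => ?_
    refine ⟨Set.mem_univ _, ?_⟩
    by_contra hne
    apply ht
    show (1 / (T.lstar : ℝ)) * vol vQ₀ c _ t.2 (U.1 t) = 0
    rw [vol_of_ne vQ₀ c hne, mul_zero]
  hul_nonempty := fun j vQ H hH => by
    rcases hH with rfl | rfl
    exacts [⟨0, rfl⟩, ⟨0, Set.mem_univ 0⟩]
  theta_nonempty := fun i vQ => by rw [thetaRegion3_eq]; exact ⟨0, rfl⟩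
  finite := thetaFinite vQ₀ c

/-- "`|log(q)| > 0`" holds in the witness when `c > 0` (`−|log(q)| = −c < 0`). [folklore] -/
theorem absLogQPos (hc : 0 < c) : (setting vQ₀ c).AbsLogQPos := by
  show (setting vQ₀ c).negLogQ < 0; rw [negLogQ_eq]; linarith

/-- **The typed Corollary 3.12 FAILS in the witness** when `c > 0`: `−|log(q)| = −c > −2c = −|log(Θ)|`. [folklore] -/
theorem not_statement (hc : 0 < c) : ¬ (setting vQ₀ c).Statement := by
  rintro ⟨-, hle⟩
  rw [negLogQ_eq, negLogTheta_eq, WithTop.coe_le_coe] at hle; linarith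

/-- **Index-generic, volume-prescribed gap witness**: over EVERY `T` and for EVERY `c > 0`: typed Thm. 3.11
(i)∧(ii)∧(iii), every bridge hypothesis, `|log(q)| > 0`, `−|log(q)| = −c` EXACTLY, and typed Cor. 3.12 FALSE
(A1's `thm311_bridgeHyps_not_imp_statement` is the shape `T = toyIndex`, `c = 1`). [folklore] -/
theorem exists_gapWitness (T : ThetaIndex) (c : ℝ) (hc : 0 < c) :
    ∃ (F : FullSituation T) (P : Setting F.toLatticeSituation.toSituation),
      F.Statement ∧ BridgeHyps P ∧ P.AbsLogQPos ∧ P.negLogQ = -c ∧ ¬ P.Statement := by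
  obtain ⟨v, -⟩ := T.Vbad_nonempty
  exact ⟨full (T.over v) c, setting (T.over v) c, full_statement _ c, bridgeHyps _ c hc.le,
    absLogQPos _ c hc, negLogQ_eq _ c, not_statement _ c hc⟩

end GapWitnessProv

open Thm311 Cor312 Literature.IUT.HodgeTheaters NumberField in
/-- **TEAM A GAP ISOLATION AT THE PROVENANCE LEVEL ([IUTchIII] Cor. 3.12, Step (xi); support piece A-4′).**
For EVERY collection of initial Θ-data `D` ([IUTchI] Def. 3.1, `InitialThetaData`) with `log(q) > 0` ([IUTchIV] p. 23;
Cor. 3.12 "`|log(q)| > 0`") there is, over THE index skeleton of `D` (c312-5's `thetaIndexOfInitial D`), a setting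
`P` that IS "the situation of Thm. 3.11 / Cor. 3.12 OF `D`" in the cell's provenance sense (c312-8's
`Cor312Prov.IsSettingOf D P`) with typed Thm. 3.11 (i)∧(ii)∧(iii) IN FULL, every bridge hypothesis, `|log(q)| > 0` —
and typed Cor. 3.12 FALSE. So «provenance» is not an input that could close a (P)-derivation: the non-following
inference sits in the glue fields `Cor312.Setting.thetaRegionOf`/`qRegionOf` (REAL Kummer-image containers, R1/R2),
at Step (xi) strength. Interface/provenance level only; no judgement on print. [folklore] -/
theorem thm311_bridgeHyps_isSettingOf_not_imp_statement {F K Fbar : Type} [Field F] [NumberField F]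
    [Field K] [NumberField K] [Algebra F K] [Field Fbar] [Algebra F Fbar] [Algebra K Fbar]
    {E : WeierstrassCurve F} [E.IsElliptic] {l : ℕ} {Pb : BadPlacePredicates K}
    (D : InitialThetaData F K Fbar E l Pb) (hq : 0 < Cor312Prov.logq D) :
    ∃ (F₁ : FullSituation (Thm311.Real.thetaIndexOfInitial D))
      (P : Setting F₁.toLatticeSituation.toSituation),
      Cor312Prov.IsSettingOf D P ∧ F₁.Statement ∧ BridgeHyps P ∧ P.AbsLogQPos ∧ ¬ P.Statement := by
  have hl : 0 < (l : ℝ) := by exact_mod_cast lt_of_lt_of_le (by norm_num) D.five_le_l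
  have hc : 0 < Cor312Prov.absLogq D := by unfold Cor312Prov.absLogq; positivity
  obtain ⟨F₁, P, hF, hB, hA, hq', hN⟩ :=
    GapWitnessProv.exists_gapWitness (Thm311.Real.thetaIndexOfInitial D) (Cor312Prov.absLogq D) hc
  exact ⟨F₁, P, Cor312Prov.isSettingOf_ofInitial D P hq', hF, hB, hA, hN⟩

end Cor312Vol

end IUTFork

end Summit.ABC

end
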